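import Summits.BirchSwinnertonDyer.BirchSwinnertonDyer.Theorems.ClassRecordThreeEulerHalvesAtThreeCartanCoverReduction
import Summits.BirchSwinnertonDyer.BirchSwinnertonDyer.Theorems.ClassRecordThreeEulerHalvesAtThreeCartanTorusCubeCutCyclic
import Summits.BirchSwinnertonDyer.BirchSwinnertonDyer.Theorems.ClassRecordThreeEulerHalvesAtThreeResidualUpperBoundCartanEmptyDegreeIndepTransport
import Literature.NumberTheory.EllipticCurves.NewformsLevelRaising
import HarnessLib

/-!
# Crux NUM `CartanOnePlaceDegreeLawAtThree`, analytic dictionary D1 — slice 3: PINNING FOR UNITS (`redHom γ ∈ T_η ↔ γ ∈ X.Gamma`) and the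
# DOCKING `u_C` of a form on the Cartan curve into the induced module (the unique `T_η`-invariant extension), with its period lattice

Seat `bsd-stepL-tam3-p1` g26 (LEAD of 19109 ∕ 23422; `--supports` 23422; memo `HOME/tam3-p1/g26/NUM-LINES-AND-D1-DESIGN-g26.md` §4 (iii)); continues
`…CartanCoverDefs` (p726336) and `…CartanCoverReduction` (p726932). For a reduction datum `R : CoverReduction X q`, a Cartan place `q ∈ C` and a form
`F ∈ S₂(X.Gamma)` (in the dictionary: `F = Q.form` of the class-minimal `Q : CartanParametrizationData X W₁`):
* `redHom_mem_torus_iff` — PROVED: `redHom γ` commutes with `η` iff `γ ∈ X.Gamma` (pinning `mem_O_iff` + the tree's «a unit commuting with `η` is `a·1 + t·η`»,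
  `CartanTorusCubeCut.lin_coord_of_mem`).
* `restrictGamma` (`S₂(X.Gamma) → S₂(Γ̄(q))`, the tree's `cuspFormOfLE`) and `coverRep_restrictGamma_of_mem` — `X.Gamma` fixes restricted `X.Gamma`-forms.
* `dockNonsplit R hq F : R.IndCuspForm` — PROVED well defined: on the double coset `redHom(ι(O₀'¹))·T_η` it is `g = redHom γ · t ↦ ρ(γ) F|_{Γ̄}` (independent of
  the decomposition by `redHom_mem_torus_iff`), zero off it; `dockNonsplit_apply_one = F|_{Γ̄}`; `T_η`-INVARIANT under `indRep` (`indRep_dockNonsplit_of_mem_torus`);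
  every component has its `Γ̄(q)`-periods in `Λ` as soon as `F` has its `X.Gamma`-periods in `Λ` (`hasPeriodsIn_dockNonsplit`, by the tree's transport
  `CartanDegree.hasPeriodsIn_slash_of_conjAct_eq`).
(When `redHom` is onto `SL₂(𝔽_q)` — strong approximation, print fact M0 — the double coset is all of `GL₂(𝔽_q)` since `det : T_η → 𝔽_q^×` is onto, and `dockNonsplit F`
is THE `T_η`-invariant element of the induced module with value `F` at `1`; that surjectivity is not used here.) Definitions + elementary lemmas only; nothing about
degrees, NUM, (F2b♮), 23422, 19109 or any curve; BSD is proved for no curve.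
[cite: KohenPacetti2016, §1.3 and §2 (arXiv:1403.7801v3 pp. 5–8)] [cite: CaiShuTian2014, §1.2 p. 5 and Prop. 3.8 p. 21]
-/

set_option linter.dupNamespace false
set_option autoImplicit false

noncomputable section

open scoped Classical Pointwise MatrixGroups

namespace Summit.BirchSwinnertonDyer.BirchSwinnertonDyer.Theorems.CartanCover

open Literature.NumberTheory.Automorphic Literature.NumberTheory.EllipticCurves.ModularForms
open CartanTorusCubeCut (torusSubgroup mem_torusSubgroup lin lin_comm lin_coord_of_mem)

variable {D M : ℕ} {C : Finset ℕ} {X : CartanLevelCurveData D M C} {q : ℕ}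

/-! ## §1 Units of `X.Gamma` inside `ι(O₀'¹)` and pinning for units -/

/-- For `γ ∈ X.Gamma` the lift `unitLift γ` lies in the Cartan order `X.O`. -/
theorem unitLift_mem_O_of_mem_Gamma {γ : coverUnits X q} (h : (γ : GL (Fin 2) ℝ) ∈ X.Gamma) : (unitLift γ : X.B) ∈ X.O := by
  obtain ⟨⟨x, hx, hxg⟩, -, -⟩ := h
  have e : unitLift γ = ⟨x, le_coverOrder X q hx⟩ := unitLift_eq_of_ι_eq γ (le_coverOrder X q hx) hxg
  rw [e]; exact hx

/-- Conversely, if `unitLift γ` and `unitLift γ⁻¹` lie in `X.O` then `γ ∈ X.Gamma`. -/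
theorem mem_Gamma_of_unitLift_mem_O {γ : coverUnits X q} (h : (unitLift γ : X.B) ∈ X.O) (h' : (unitLift γ⁻¹ : X.B) ∈ X.O) :
    (γ : GL (Fin 2) ℝ) ∈ X.Gamma := by
  refine ⟨⟨(unitLift γ : X.B), h, ι_unitLift γ⟩, ⟨(unitLift γ⁻¹ : X.B), h', ?_⟩, γ.2.2.2⟩
  rw [ι_unitLift, Subgroup.coe_inv]

/-! ## §2 Restriction of `X.Gamma`-forms to `Γ̄(q)` -/

/-- `S₂(X.Gamma) → S₂(Γ̄(q))` for a Cartan place `q ∈ C` (the tree's `cuspFormOfLE` along `principalLevel_le_Gamma`). -/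
def restrictGamma (hq : q ∈ C) (F : CuspForm X.Gamma 2) : CuspForm (principalLevel X q) 2 :=
  cuspFormOfLE (principalLevel_le_Gamma X q hq) F

/-- `restrictGamma` does not change the function. -/
@[simp] theorem coe_restrictGamma (hq : q ∈ C) (F : CuspForm X.Gamma 2) : ⇑(restrictGamma hq F) = ⇑F := rfl

/-- `X.Gamma` fixes the restriction of an `X.Gamma`-form: `ρ(γ) F|_{Γ̄} = F|_{Γ̄}` for `γ ∈ X.Gamma`. -/
theorem coverRep_restrictGamma_of_mem (hq : q ∈ C) (F : CuspForm X.Gamma 2) {γ : coverUnits X q} (hγ : (γ : GL (Fin 2) ℝ) ∈ X.Gamma) :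
    coverRep X q γ (restrictGamma hq F) = restrictGamma hq F := by
  apply CuspForm.ext; intro τ
  rw [coverRep_apply, coe_coverSlash, coe_restrictGamma]
  exact congr_fun (SlashInvariantForm.slash_action_eqn F _ (X.Gamma.inv_mem hγ)) τ


/-- The zero function has all its periods in any set containing `0`. -/
theorem hasPeriodsIn_zero {Γ : Subgroup (GL (Fin 2) ℝ)} {Λ : Set ℂ} (h0 : (0 : ℂ) ∈ Λ) :
    HasPeriodsIn Γ (⇑(0 : CuspForm Γ 2)) Λ := by
  intro γ _ z
  simp only [segmentIntegral, CuspForm.coe_zero, Pi.zero_apply, zero_mul, intervalIntegral.integral_zero]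
  exact h0

/-- Periods restrict along `Γ̄(q) ≤ X.Gamma`. -/
theorem hasPeriodsIn_restrictGamma (hq : q ∈ C) (F : CuspForm X.Gamma 2) {Λ : Set ℂ} (hF : HasPeriodsIn X.Gamma (⇑F) Λ) :
    HasPeriodsIn (principalLevel X q) (⇑(restrictGamma hq F)) Λ :=
  fun γ hγ z => hF γ (principalLevel_le_Gamma X q hq hγ) z

/-- `ρ(γ)` preserves the period condition on `Γ̄(q)` (transport along `γ Γ̄ γ⁻¹ = Γ̄`, the tree's `hasPeriodsIn_slash_of_conjAct_eq`). -/
theorem hasPeriodsIn_coverRep {Λ : Set ℂ} (γ : coverUnits X q) (G₀ : CuspForm (principalLevel X q) 2)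
    (hG : HasPeriodsIn (principalLevel X q) (⇑G₀) Λ) : HasPeriodsIn (principalLevel X q) (⇑(coverRep X q γ G₀)) Λ := by
  rw [coverRep_apply, coe_coverSlash]
  have hΓ : ConjAct.toConjAct ((γ : GL (Fin 2) ℝ)⁻¹)⁻¹ • principalLevel X q = principalLevel X q := by
    rw [inv_inv]; exact conjAct_smul_principalLevel X q γ.2
  have hdet : 0 < ((γ : GL (Fin 2) ℝ)⁻¹).det.val := by
    rw [map_inv, Units.val_inv_eq_inv_val]
    exact inv_pos.mpr (det_pos_of_mem_coverUnits X q γ.2)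
  exact CartanDegree.hasPeriodsIn_slash_of_conjAct_eq hΓ G₀ hdet hG


namespace CoverReduction

variable [Fact q.Prime] (R : CoverReduction X q)

/-- `red (unitLift γ) ∈ 𝔽_q[η]` for `γ ∈ X.Gamma` (pinning, forward). -/
theorem exists_redHom_eq_lin_of_mem_Gamma {γ : coverUnits X q} (h : (γ : GL (Fin 2) ℝ) ∈ X.Gamma) :
    ∃ p : ZMod q × ZMod q, ((R.redHom γ : GL (Fin 2) (ZMod q)) : Matrix (Fin 2) (Fin 2) (ZMod q)) = lin R.η p := by
  obtain ⟨a, b, hab⟩ := (R.mem_O_iff (unitLift γ)).mp (unitLift_mem_O_of_mem_Gamma h)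
  exact ⟨(a, b), by rw [coe_redHom, hab]; rfl⟩

/-- **PINNING FOR UNITS**: `redHom γ` commutes with `η` iff `γ ∈ X.Gamma`. -/
theorem redHom_mem_torus_iff (γ : coverUnits X q) : R.redHom γ ∈ torusSubgroup R.η ↔ (γ : GL (Fin 2) ℝ) ∈ X.Gamma := by
  constructor
  · intro hγ
    have key : ∀ δ : coverUnits X q, R.redHom δ ∈ torusSubgroup R.η → (unitLift δ : X.B) ∈ X.O := by
      intro δ hδ
      have hlin := lin_coord_of_mem R.η_irred hδ
      refine (R.mem_O_iff (unitLift δ)).mpr ⟨(CartanTorusCubeCut.coord R.η ((R.redHom δ : GL (Fin 2) (ZMod q)) : Matrix (Fin 2) (Fin 2) (ZMod q))).1,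
        (CartanTorusCubeCut.coord R.η ((R.redHom δ : GL (Fin 2) (ZMod q)) : Matrix (Fin 2) (Fin 2) (ZMod q))).2, ?_⟩
      exact hlin.symm
    exact mem_Gamma_of_unitLift_mem_O (key γ hγ) (key γ⁻¹ (by rw [map_inv]; exact (torusSubgroup R.η).inv_mem hγ))
  · intro hγ
    obtain ⟨p, hp⟩ := R.exists_redHom_eq_lin_of_mem_Gamma hγ
    rw [mem_torusSubgroup, hp]
    exact lin_comm R.η p

/-! ## §3 The docking `u_C` of `F ∈ S₂(X.Gamma)` into the induced module -/

/-- The double coset `redHom(ι(O₀'¹)) · T_η ⊆ GL₂(𝔽_q)` (as a set). -/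
def nonsplitCoset : Set (GL (Fin 2) (ZMod q)) := {g | ∃ γ : coverUnits X q, (R.redHom γ)⁻¹ * g ∈ torusSubgroup R.η}

/-- Membership in the double coset (definitional). -/
theorem mem_nonsplitCoset_iff (g : GL (Fin 2) (ZMod q)) :
    g ∈ R.nonsplitCoset ↔ ∃ γ : coverUnits X q, (R.redHom γ)⁻¹ * g ∈ torusSubgroup R.η := Iff.rfl

/-- Two decompositions `g = redHom γ₀ · t₀ = redHom γ₁ · t₁` differ by an element of `X.Gamma`: `γ₁⁻¹ γ₀ ∈ X.Gamma`. -/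
theorem inv_mul_mem_Gamma_of_witnesses {g : GL (Fin 2) (ZMod q)} {γ₀ γ₁ : coverUnits X q}
    (h₀ : (R.redHom γ₀)⁻¹ * g ∈ torusSubgroup R.η) (h₁ : (R.redHom γ₁)⁻¹ * g ∈ torusSubgroup R.η) :
    ((γ₁⁻¹ * γ₀ : coverUnits X q) : GL (Fin 2) ℝ) ∈ X.Gamma := by
  rw [← R.redHom_mem_torus_iff]
  have e : R.redHom (γ₁⁻¹ * γ₀) = ((R.redHom γ₁)⁻¹ * g) * ((R.redHom γ₀)⁻¹ * g)⁻¹ := by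
    rw [map_mul, map_inv]; group
  rw [e]
  exact (torusSubgroup R.η).mul_mem h₁ ((torusSubgroup R.η).inv_mem h₀)

/-- Hence the value `ρ(γ) F|_{Γ̄}` does not depend on the decomposition. -/
theorem coverRep_eq_of_witnesses (hq : q ∈ C) (F : CuspForm X.Gamma 2) {g : GL (Fin 2) (ZMod q)} {γ₀ γ₁ : coverUnits X q}
    (h₀ : (R.redHom γ₀)⁻¹ * g ∈ torusSubgroup R.η) (h₁ : (R.redHom γ₁)⁻¹ * g ∈ torusSubgroup R.η) :
    coverRep X q γ₀ (restrictGamma hq F) = coverRep X q γ₁ (restrictGamma hq F) := by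
  have hfix := coverRep_restrictGamma_of_mem hq F (R.inv_mul_mem_Gamma_of_witnesses h₀ h₁)
  -- `hfix : coverRep (γ₁⁻¹ * γ₀) F̄ = F̄`; apply `coverRep γ₁` to both sides
  have h := congrArg (coverRep X q γ₁) hfix
  rw [← Module.End.mul_apply, ← map_mul, mul_inv_cancel_left] at h
  exact h

/-- **`u_C := dockNonsplit F`**: the element of the induced module equal to `ρ(γ) F|_{Γ̄}` at `g = redHom γ · t` (`t ∈ T_η`) and to `0` off the double coset. -/
def dockNonsplit (hq : q ∈ C) (F : CuspForm X.Gamma 2) : R.IndCuspForm :=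
  ⟨fun g => if h : g ∈ R.nonsplitCoset then coverRep X q (Classical.choose h) (restrictGamma hq F) else 0, by
    intro γ g
    by_cases hg : g ∈ R.nonsplitCoset
    · have hg' : (R.redHom γ * g) ∈ R.nonsplitCoset := by
        obtain ⟨γ₀, h₀⟩ := hg
        refine ⟨γ * γ₀, ?_⟩
        rwa [map_mul, mul_inv_rev, mul_assoc, inv_mul_cancel_left]
      simp only [dif_pos hg, dif_pos hg']
      -- witnesses: `choose hg'` for `redHom γ * g`, and `γ * choose hg` as another witness for it
      have h₁ := Classical.choose_spec hg'
      have h₀ : (R.redHom (γ * Classical.choose hg))⁻¹ * (R.redHom γ * g) ∈ torusSubgroup R.η := by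
        rw [map_mul, mul_inv_rev, mul_assoc, inv_mul_cancel_left]
        exact Classical.choose_spec hg
      rw [R.coverRep_eq_of_witnesses hq F h₁ h₀, map_mul, Module.End.mul_apply]
    · have hg' : ¬ (R.redHom γ * g) ∈ R.nonsplitCoset := by
        rintro ⟨γ₁, h₁⟩
        exact hg ⟨γ⁻¹ * γ₁, by rwa [map_mul, map_inv, mul_inv_rev, inv_inv, mul_assoc]⟩
      simp only [dif_neg hg, dif_neg hg', map_zero]⟩

/-- The value of `u_C` on the double coset, for ANY decomposition witness. -/
theorem dockNonsplit_apply_of_witness (hq : q ∈ C) (F : CuspForm X.Gamma 2) {g : GL (Fin 2) (ZMod q)} {γ : coverUnits X q}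
    (h : (R.redHom γ)⁻¹ * g ∈ torusSubgroup R.η) : (R.dockNonsplit hq F).1 g = coverRep X q γ (restrictGamma hq F) := by
  have hg : g ∈ R.nonsplitCoset := ⟨γ, h⟩
  change (if h' : g ∈ R.nonsplitCoset then coverRep X q (Classical.choose h') (restrictGamma hq F) else 0) = _
  rw [dif_pos hg]
  exact R.coverRep_eq_of_witnesses hq F (Classical.choose_spec hg) h

/-- The value of `u_C` off the double coset is `0`. -/
theorem dockNonsplit_apply_of_not (hq : q ∈ C) (F : CuspForm X.Gamma 2) {g : GL (Fin 2) (ZMod q)} (h : ¬ g ∈ R.nonsplitCoset) :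
    (R.dockNonsplit hq F).1 g = 0 := by
  change (if h' : g ∈ R.nonsplitCoset then coverRep X q (Classical.choose h') (restrictGamma hq F) else 0) = _
  rw [dif_neg h]

/-- **`u_C(1) = F|_{Γ̄}`.** -/
theorem dockNonsplit_apply_one (hq : q ∈ C) (F : CuspForm X.Gamma 2) : (R.dockNonsplit hq F).1 1 = restrictGamma hq F := by
  have h : (R.redHom 1)⁻¹ * (1 : GL (Fin 2) (ZMod q)) ∈ torusSubgroup R.η := by rw [map_one, inv_one, mul_one]; exact (torusSubgroup R.η).one_mem
  rw [R.dockNonsplit_apply_of_witness hq F h, map_one, Module.End.one_apply]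

/-- **`u_C` is `T_η`-invariant** under the `GL₂(𝔽_q)`-action on the induced module. -/
theorem indRep_dockNonsplit_of_mem_torus (hq : q ∈ C) (F : CuspForm X.Gamma 2) {t : GL (Fin 2) (ZMod q)} (ht : t ∈ torusSubgroup R.η) :
    R.indRep t (R.dockNonsplit hq F) = R.dockNonsplit hq F := by
  apply Subtype.ext; funext g
  rw [indRep_apply]
  by_cases hg : g ∈ R.nonsplitCoset
  · obtain ⟨γ, hγ⟩ := hg
    have hγt : (R.redHom γ)⁻¹ * (g * t) ∈ torusSubgroup R.η := by
      rw [← mul_assoc]; exact (torusSubgroup R.η).mul_mem hγ ht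
    rw [R.dockNonsplit_apply_of_witness hq F hγt, R.dockNonsplit_apply_of_witness hq F hγ]
  · have hgt : ¬ (g * t) ∈ R.nonsplitCoset := by
      rintro ⟨γ, hγ⟩
      refine hg ⟨γ, ?_⟩
      have := (torusSubgroup R.η).mul_mem hγ ((torusSubgroup R.η).inv_mem ht)
      rwa [← mul_assoc, mul_inv_cancel_right] at this
    rw [R.dockNonsplit_apply_of_not hq F hgt, R.dockNonsplit_apply_of_not hq F hg]

/-! ## §4 Periods of the docked form -/

/-- **Every component of `u_C` has its `Γ̄(q)`-periods in `Λ`** as soon as `F` has its `X.Gamma`-periods in `Λ ∋ 0` (in the dictionary `Λ = Λ(W₁)` by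
`Q.period_mem`). -/
theorem hasPeriodsIn_dockNonsplit (hq : q ∈ C) (F : CuspForm X.Gamma 2) {Λ : Set ℂ} (h0 : (0 : ℂ) ∈ Λ)
    (hF : HasPeriodsIn X.Gamma (⇑F) Λ) (g : GL (Fin 2) (ZMod q)) : HasPeriodsIn (principalLevel X q) (⇑((R.dockNonsplit hq F).1 g)) Λ := by
  by_cases hg : g ∈ R.nonsplitCoset
  · obtain ⟨γ, hγ⟩ := hg
    rw [R.dockNonsplit_apply_of_witness hq F hγ]
    exact hasPeriodsIn_coverRep γ _ (hasPeriodsIn_restrictGamma hq F hF)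
  · rw [R.dockNonsplit_apply_of_not hq F hg]
    exact hasPeriodsIn_zero h0

end CoverReduction

end Summit.BirchSwinnertonDyer.BirchSwinnertonDyer.Theorems.CartanCover

end
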